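import Mathlib
import Summits.Parity.BatemanHorn.Theses.AlmostPrimeZeros

/-!
# Sketch — crux `NonHyperbolicityBound` (stmt-Parity-14760), ideator 1, round 1

First lemmas of the idea card `parity-sector-two-constants` (no proofs required at ideate stage;
everything here must elaborate).

* `SectorTwoConstants` — the two-constants / Phragmén–Lindelöf transfer in the truncated parity
  sector `{z : |arg(-z)| ≤ δ, ‖z‖ ≤ R}` (δ < π/4) with the explicit polynomial comparison function
  `exp(-μ z - c z²)`, `c = U/(R² cos 2δ)`: a one-sided bound on the two RAYS `|arg(-z)| = δ` plus a
  (trivial) bound `U` on the ARC `‖z‖ = R` give the bound inside the whole sector with leak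
  `U ‖z‖²/(R² cos 2δ)`. Provable now (maximum modulus principle for
  `P(z)·exp(-μ z - c z²)` on the truncated sector).
* `SectorTwoConstantsPow` — same with a growing ray tolerance `b (1+‖z‖)^β`, `β < 2`
  (comparison function adds the analytic `b 2^β (-z)^β / cos(βδ)`, principal branch, whose real part
  majorises `b(1+‖z‖)^β ≤ b 2^β (1+‖z‖^β)` on the rays).
* `NonParitySectorMajorant` — the TRANSFER TARGET C⁺ of the card: a one-sided
  Landau–Selberg–Delange-SIZE majorant of the almost-prime polynomial OUTSIDE the parity sector
  `|arg(-z)| < π/5`, on `‖z‖ ≤ (log log x)²`, tolerance `b(1+‖z‖)^{3/2}` (the exponent of the tree's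
  `…JensenStieltjesMajorant.stub_jensenCount`).
* `FarMomentAlongSystem` — the parity-free exponential-moment (anatomy) input (M) on the positive
  axis for all `y ≥ 1` (shape of the PROVED k = 1 `stub_rankinMajorant` / SRLA's `stub_farMoment`).
* `NonHyperbolicity_of_sector` — the claimed composition (statement only):
  `NonParitySectorMajorant → FarMomentAlongSystem → NonHyperbolicityBound`.
-/

namespace Summit.Parity.BatemanHorn.Cruxes.NonHyperbolicityBound.Sketch

open scoped BigOperators
open Summit.Parity.BatemanHorn.Theses.AlmostPrimeZeros

/-- Two-constants transfer in the truncated parity sector, constant ray tolerance (β = 0).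
Rays: `|arg(-z)| = δ`; arc: `‖z‖ = R`, `|arg(-z)| ≤ δ`; conclusion on the closed truncated sector. -/
def SectorTwoConstants : Prop :=
  ∀ (P : Polynomial ℂ) (μ a B U R δ : ℝ), 0 < R → 0 < δ → δ < Real.pi / 4 → 0 ≤ B → 0 ≤ U →
    (∀ z : ℂ, ‖z‖ ≤ R → |Complex.arg (-z)| = δ →
        ‖P.eval z‖ ≤ Real.exp (a + μ * z.re + B)) →
    (∀ z : ℂ, ‖z‖ = R → |Complex.arg (-z)| ≤ δ →
        ‖P.eval z‖ ≤ Real.exp (a + μ * z.re + U)) →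
    ∀ z : ℂ, ‖z‖ ≤ R → |Complex.arg (-z)| ≤ δ →
        ‖P.eval z‖ ≤ Real.exp (a + μ * z.re + B + U * ‖z‖ ^ 2 / (R ^ 2 * Real.cos (2 * δ)))

/-- Same transfer with a growing one-sided tolerance `b (1 + ‖z‖)^β` on the rays, `0 ≤ β < 2`
(what Jensen counting at radius `t` tolerates is `t^{2-η}`); the constant `1 / cos (β δ)` comes from the
harmonic majorant `b · Re((-z)^β) / cos(β δ)` of `b ‖z‖^β` on the rays. -/
def SectorTwoConstantsPow : Prop :=
  ∀ (P : Polynomial ℂ) (μ a b β U R δ : ℝ), 0 < R → 0 < δ → δ < Real.pi / 4 → 0 ≤ b → 0 ≤ β → β < 2 →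
    0 ≤ U →
    (∀ z : ℂ, ‖z‖ ≤ R → |Complex.arg (-z)| = δ →
        ‖P.eval z‖ ≤ Real.exp (a + μ * z.re + b * (1 + ‖z‖) ^ β)) →
    (∀ z : ℂ, ‖z‖ = R → |Complex.arg (-z)| ≤ δ →
        ‖P.eval z‖ ≤ Real.exp (a + μ * z.re + U)) →
    ∀ z : ℂ, ‖z‖ ≤ R → |Complex.arg (-z)| ≤ δ →
        ‖P.eval z‖ ≤ Real.exp (a + μ * z.re + b * 2 ^ β * (1 + ‖z‖ ^ β / Real.cos (β * δ))
          + U * ‖z‖ ^ 2 / (R ^ 2 * Real.cos (2 * δ)))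

/-- TRANSFER TARGET C⁺ (conjectural, the card's crux-sized input): one-sided LSD-size majorant of the
almost-prime polynomial OUTSIDE the parity sector `|arg(-z)| < π/5`, on the disc `‖z‖ ≤ (log log x)²`,
with tolerance `b (1 + ‖z‖)^{3/2}`. Nothing is asked on or near the negative real axis. -/
def NonParitySectorMajorant : Prop :=
  ∀ (k : ℕ) (f : Fin k → Polynomial ℤ), Literature.NumberTheory.Sieve.IsBatemanHornSystem f →
    ∃ b : ℝ, ∃ x₀ : ℕ, ∀ x : ℕ, x₀ ≤ x → ∀ z : ℂ,
      ‖z‖ ≤ Real.log (Real.log x) ^ 2 → Real.pi / 5 ≤ |Complex.arg (-z)| →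
      ‖∑ n ∈ Finset.range (x + 1),
          z ^ (∑ i, (((f i).eval (n : ℤ)).toNat.factorization.sum fun _ v => min v 2))‖
        ≤ ((x : ℝ) + 1) *
          Real.exp ((k : ℝ) * Real.log (Real.log x) * (z.re - 1) + b * (1 + ‖z‖) ^ (3 / 2 : ℝ))

/-- Parity-free anatomy input (M) on the POSITIVE axis (positive terms only): exponential moments of
`s_f` for all real `y ≥ 1` — the shape of the k = 1 line's PROVED `stub_rankinMajorant` and of SRLA's
shared joint `stub_farMoment` (content at `y ≤ (log x)^{2/3}`; beyond, the degree bound makes it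
trivial); it feeds the TRIVIAL arc bound `‖S_x(z)‖ ≤ S_x(‖z‖)` of the two-constants transfer (used at
`‖z‖ = R_s ≍ (log log x)^{3/2}`) and the global majorant of `stub_jensenCount` (far tail). -/
def FarMomentAlongSystem : Prop :=
  ∀ (k : ℕ) (f : Fin k → Polynomial ℤ), Literature.NumberTheory.Sieve.IsBatemanHornSystem f →
    ∃ C : ℝ, ∃ x₀ : ℕ, ∀ x : ℕ, x₀ ≤ x → ∀ y : ℝ, 1 ≤ y →
      ((∑ n ∈ Finset.range (x + 1),
          y ^ (∑ i, (((f i).eval (n : ℤ)).toNat.factorization.sum fun _ v => min v 2)) : ℝ))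
        ≤ ((x : ℝ) + 1) * Real.exp (C * y * Real.log (Real.log x) + C * y ^ (3 / 2 : ℝ))

/-- The composition the card claims (statement only at ideate stage): the two conjectural inputs,
through `SectorTwoConstantsPow` + the tree's Jensen/Stieltjes stubs, give `SystemZeroRepulsion` and a
fortiori the crux (termwise `(Im ρ)² ≤ ‖1-ρ‖²`). -/
def NonHyperbolicity_of_sector : Prop :=
  NonParitySectorMajorant → FarMomentAlongSystem → NonHyperbolicityBound

/-- Sanity: the crux decl is the route's, by name. -/
example : NonHyperbolicity_of_sector =
    (NonParitySectorMajorant → FarMomentAlongSystem →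
      Summit.Parity.BatemanHorn.Theses.AlmostPrimeZeros.NonHyperbolicityBound) := rfl

end Summit.Parity.BatemanHorn.Cruxes.NonHyperbolicityBound.Sketch
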